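import Literature.Probability.LatticeModels.MeanFieldBoundGHS
import HarnessLib

/-!
# Exponential decay of the plus-state two-point function from the finite-size criterion:
# the discharge of `dct_twoPointPlus_exponentialDecay`

Topic `Probability/LatticeModels`, namespace `Literature.Probability.LatticeModels`. This file
discharges the named fact `dct_twoPointPlus_exponentialDecay` of `MeanFieldBound`
(Duminil-Copin–Tassion, CMP 343 (2016) 725, Thm. 2.1, third item, proved in §2.5 of
arXiv:1502.03050 with `β̃_c` in place of `β_c`): for the nearest-neighbour Ising model on `ℤ^d`,
`d ≥ 1`, `β > 0` and a finite `S ∋ 0` with `φ_β(S) < 1`, there are `c > 0` and `C` with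
`⟨σ₀σ_x⟩⁺_{β,0} ≤ C e^{-c‖x‖}` for all `x` (`dct_twoPointPlus_exponentialDecay_holds`, with
`C = 1`).

## The proof

Duminil-Copin–Tassion prove their modified Simon inequality (Lemma 2.7) for the plus state
`⟨·⟩⁺_β = lim_{h↘0} lim_{Λ↑ℤ^d} ⟨·⟩_{Λ,β,h}` by the backbone representation of random currents
with a ghost field (finite volume, `h ≥ 0`), then `Λ ↑ ℤ^d`, then `h ↘ 0`, and iterate it
`⌊n/L⌋` times (arXiv:1502.03050, pp. 19–20). The tree proves Lemma 2.7 in finite volume for the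
free boundary condition at zero field (`ModifiedSimonInequality`) and deduces the decay of the
*free* two-point function, `⟨σ₀σ_x⟩^∅_{β,0} ≤ e^{-c‖x‖}` whenever `φ_β(S) < 1`
(`SharpnessSubcritical.twoPointFree_exp_decay_of_dctIsingPhi_lt_one`; all its inputs are tree
theorems). Here the decay is transferred to the plus state with the GHS inequality (the tree
theorem `gksExpect_ghs`, Griffiths–Hurst–Sherman 1970), instead of re-running the random-current
argument with `+` boundary condition:

1. **GHS interpolation bound for two-point functions** (Part A; spin systems `ν_{Λ;K}` of
   `GKSInequalities`, `Kᵢ ≥ 0` on supports of at most two sites, a set `B` of one-body terms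
   `Kᵢ σ_{pᵢ}` switched on linearly by `cplAt K B t`, `LebowitzInequality`):
   `d/dt ⟨σ_aσ_z⟩_t = ∑_{i∈B} Kᵢ (⟨σ_aσ_zσ_{pᵢ}⟩_t - ⟨σ_aσ_z⟩_t⟨σ_{pᵢ}⟩_t)`, and GHS
   (`u₃(a, z, p) ≤ 0`) bounds each bracket by
   `⟨σ_aσ_p⟩_t⟨σ_z⟩_t + ⟨σ_zσ_p⟩_t⟨σ_a⟩_t - 2⟨σ_a⟩_t⟨σ_z⟩_t⟨σ_p⟩_t ≤ ⟨σ_a⟩_K + ⟨σ_z⟩_K`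
   (GKS I, `|⟨σσ⟩| ≤ 1`, Griffiths' comparison `⟨σ_x⟩_t ≤ ⟨σ_x⟩_K` for `t ≤ 1`), so the mean
   value inequality gives `⟨σ_aσ_z⟩_K - ⟨σ_aσ_z⟩_{K off B} ≤ (∑_{i∈B} Kᵢ)(⟨σ_a⟩_K + ⟨σ_z⟩_K)`
   (`gksExpect_pair_sub_cplOff_le`; the two-point companion of
   `MeanFieldBoundGHS.gksExpect_spinAt_sub_cplOff_le`).
2. **Ising model** (Part A'): the `+` boundary condition is the free one plus the one-body terms
   `β σ_x`, one for each boundary bond `{x,y}`, `x ∈ Λ`, `y ∉ Λ` (Friedli–Velenik 2017, §3.8.1,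
   p. 141), so for `β, h ≥ 0` and `a, z ∈ Λ`,
   `⟨σ_aσ_z⟩⁺_{Λ;β,h} - ⟨σ_aσ_z⟩^∅_{Λ;β,h} ≤ β · #{(x,y) | x ∈ Λ, y ∉ Λ, x ∼ y} · (⟨σ_a⟩⁺_Λ + ⟨σ_z⟩⁺_Λ)`
   (`isingTwoPoint_plus_sub_free_le_boundary`).
3. **`ℤ^d` below `β̃_c`** (Part B): the free decay and the GHS one-point bound
   `⟨σ_a⟩⁺_{Λ;β,0} ≤ β ∑_{x ∈ Λ, y ∼ x, y ∉ Λ} ⟨σ_aσ_x⟩^∅_{Λ;β,0}`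
   (`MeanFieldBoundGHS.isingCorr_plus_singleton_le_boundary_twoPoint`) give
   `⟨σ_a⟩⁺_{Λ_L;β,0} ≤ 2dβ (2L+1)^d e^{c‖a‖} e^{-cL}`, so that the right side of item 2 in the
   box `Λ_L` is `O(L^{2d} e^{-cL}) → 0`; with `⟨σ₀σ_z⟩^∅ ≤ ⟨σ₀σ_z⟩⁺` (GKS) and the box limits,
   **`⟨σ₀σ_z⟩⁺_{β,0} = ⟨σ₀σ_z⟩^∅_{β,0}` whenever `φ_β(S) < 1` for some finite `S ∋ 0`**
   (`twoPointPlus_eq_twoPointFree_of_dctIsingPhi_lt_one`), and the plus-state decay follows from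
   the free one.

This is not the printed route of §2.5 (which lets `h ↘ 0` in the positive-field Simon
inequality); it uses the GHS inequality, which the source invokes in §2.4 ([GHS70]), and yields
the printed conclusion with constant prefactor `C = 1`.

## References

* H. Duminil-Copin, V. Tassion, Comm. Math. Phys. 343 (2016) 725–745, Thm. 2.1 (third item) and
  §2.5, Lemma 2.7 (arXiv:1502.03050 numbering).
* R. B. Griffiths, C. A. Hurst, S. Sherman, J. Math. Phys. 11 (1970) 790 (GHS inequality).
* J. L. Lebowitz, Comm. Math. Phys. 35 (1974) 87, §2, Remark (ii) (truncated correlations are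
  nonincreasing in nonnegative fields).
* J. Glimm, A. Jaffe, *Quantum Physics*, 2nd ed., Springer 1987, §4.2, Prop. 4.2.1.
* S. Friedli, Y. Velenik, *Statistical Mechanics of Lattice Systems*, CUP 2017, §3.8.1 (p. 141),
  Exercise 3.25, Exercise 3.31 (p. 142), §3.9 (p. 140).
-/

noncomputable section

open Finset Filter Topology MeasureTheory Set
open scoped symmDiff

namespace Literature.Probability.LatticeModels

/-! ## Part A. The GHS interpolation bound for two-point functions -/

section GKS

variable {Λ : Type*} [Fintype Λ] [DecidableEq Λ] {ι : Type*} [DecidableEq ι]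
variable (s : Finset ι) (K : ι → ℝ) (C : ι → Finset Λ) (B : Finset ι) (p : ι → Λ)

omit [DecidableEq ι] in
/-- `0 ≤ ⟨σ_x⟩_{Λ;K}` for `Kᵢ ≥ 0` (first GKS inequality, Friedli–Velenik 2017, Thm. 3.49,
eq. (3.54), for `A = {x}`). [cite: FriedliVelenik2017, Thm. 3.49, eq. (3.54), p. 141] -/
theorem gksExpect_spinAt_nonneg (hK : ∀ i ∈ s, 0 ≤ K i) (x : Λ) :
    0 ≤ gksExpect s K C (spinAt x) := by
  rw [← spinProduct_singleton]
  exact gksExpect_spinProduct_nonneg s K C hK {x}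

omit [DecidableEq ι] in
/-- `⟨σ_xσ_y⟩_{Λ;K} ≤ 1` (`|σ_xσ_y| = 1` pointwise). [folklore] -/
theorem gksExpect_pair_le_one (K' : ι → ℝ) (x y : Λ) :
    gksExpect s K' C (fun ω => spinAt x ω * spinAt y ω) ≤ 1 := by
  have hZ := gksSum_one_pos s K' C
  rw [gksExpect, div_le_one hZ]
  simp only [gksSum]
  refine Finset.sum_le_sum fun ω _ => mul_le_mul_of_nonneg_right ?_ (gksWeight_pos s K' C ω).le
  have h : |spinAt x ω * spinAt y ω| ≤ 1 :=
    le_of_eq (by rw [abs_mul, abs_spinAt, abs_spinAt, mul_one])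
  exact (abs_le.1 h).2

/-- Griffiths' comparison inequality along the interpolation `cplAt K B t`, `t ∈ [0, 1]`,
`K ≥ 0`: `⟨σ_x⟩_{cplAt K B t} ≤ ⟨σ_x⟩_K` (Friedli–Velenik 2017, Exercise 3.31:
`|K'ᵢ| ≤ Kᵢ ⇒ ⟨σ_A⟩_{K'} ≤ ⟨σ_A⟩_K`). [cite: FriedliVelenik2017, Exercise 3.31, p. 142] -/
theorem gksExpect_spinAt_cplAt_le (hK : ∀ i ∈ s, 0 ≤ K i) {t : ℝ} (ht0 : 0 ≤ t) (ht1 : t ≤ 1)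
    (x : Λ) : gksExpect s (cplAt K B t) C (spinAt x) ≤ gksExpect s K C (spinAt x) := by
  rw [← spinProduct_singleton]
  exact gksExpect_mono_of_abs_le s C (abs_cplAt_le s K B hK ht0 ht1) {x}

/-- **GHS bound on the field-derivative of a two-point function.** Along `cplAt K B t`,
`t ∈ [0, 1]`, with `B ⊆ s` and `Kᵢ ≥ 0` on supports of at most two sites, for the one-body
observables `σ_{pᵢ}`, `i ∈ B`:
`∑_{i∈B} Kᵢ (⟨σ_aσ_zσ_{pᵢ}⟩_t - ⟨σ_aσ_z⟩_t ⟨σ_{pᵢ}⟩_t) ≤ (∑_{i∈B} Kᵢ)(⟨σ_a⟩_K + ⟨σ_z⟩_K)`: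
by the GHS inequality `u₃(a, z, pᵢ) ≤ 0` (Griffiths–Hurst–Sherman 1970; `gksExpect_ghs`) each
bracket is at most `⟨σ_aσ_{pᵢ}⟩_t⟨σ_z⟩_t + ⟨σ_zσ_{pᵢ}⟩_t⟨σ_a⟩_t - 2⟨σ_a⟩_t⟨σ_z⟩_t⟨σ_{pᵢ}⟩_t`,
which is at most `⟨σ_z⟩_t + ⟨σ_a⟩_t ≤ ⟨σ_z⟩_K + ⟨σ_a⟩_K` (GKS I, `⟨σσ⟩ ≤ 1`, Griffiths'
comparison). This is the finite-volume content of Lebowitz's remark that nonnegative fields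
change the even correlations at a rate controlled by the odd ones. [cite: Lebowitz1974, §2, Remark (ii) following the proof of the Theorem] -/
theorem sum_gksTrunc_three_cplAt_le (hK : ∀ i ∈ s, 0 ≤ K i) (hC : ∀ i ∈ s, (C i).card ≤ 2)
    (hBs : B ⊆ s) {t : ℝ} (ht0 : 0 ≤ t) (ht1 : t ≤ 1) (a z : Λ) :
    ∑ i ∈ B, K i *
        (gksExpect s (cplAt K B t) C (fun ω => spinAt a ω * spinAt z ω * spinAt (p i) ω) -
          gksExpect s (cplAt K B t) C (fun ω => spinAt a ω * spinAt z ω) *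
            gksExpect s (cplAt K B t) C (spinAt (p i))) ≤
      (∑ i ∈ B, K i) * (gksExpect s K C (spinAt a) + gksExpect s K C (spinAt z)) := by
  rw [Finset.sum_mul]
  refine Finset.sum_le_sum fun i hi => mul_le_mul_of_nonneg_left ?_ (hK i (hBs hi))
  have hKt : ∀ j ∈ s, 0 ≤ cplAt K B t j := cplAt_nonneg s K B hK ht0
  -- the GHS inequality `u₃(a, z, pᵢ) ≤ 0` at the couplings `cplAt K B t`
  have hghs : gksExpect s (cplAt K B t) C (fun ω => spinAt a ω * spinAt z ω * spinAt (p i) ω) -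
      gksExpect s (cplAt K B t) C (fun ω => spinAt a ω * spinAt z ω) *
        gksExpect s (cplAt K B t) C (spinAt (p i)) -
      gksExpect s (cplAt K B t) C (fun ω => spinAt a ω * spinAt (p i) ω) *
        gksExpect s (cplAt K B t) C (spinAt z) -
      gksExpect s (cplAt K B t) C (fun ω => spinAt z ω * spinAt (p i) ω) *
        gksExpect s (cplAt K B t) C (spinAt a) +
      2 * (gksExpect s (cplAt K B t) C (spinAt a) * gksExpect s (cplAt K B t) C (spinAt z) *
        gksExpect s (cplAt K B t) C (spinAt (p i))) ≤ 0 :=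
    gksExpect_ghs s (cplAt K B t) C hKt hC a z (p i)
  have ha0 : 0 ≤ gksExpect s (cplAt K B t) C (spinAt a) := gksExpect_spinAt_nonneg s _ C hKt a
  have hz0 : 0 ≤ gksExpect s (cplAt K B t) C (spinAt z) := gksExpect_spinAt_nonneg s _ C hKt z
  have hp0 : 0 ≤ gksExpect s (cplAt K B t) C (spinAt (p i)) :=
    gksExpect_spinAt_nonneg s _ C hKt (p i)
  have hap : gksExpect s (cplAt K B t) C (fun ω => spinAt a ω * spinAt (p i) ω) *
      gksExpect s (cplAt K B t) C (spinAt z) ≤ gksExpect s (cplAt K B t) C (spinAt z) :=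
    mul_le_of_le_one_left hz0 (gksExpect_pair_le_one s C _ a (p i))
  have hzp : gksExpect s (cplAt K B t) C (fun ω => spinAt z ω * spinAt (p i) ω) *
      gksExpect s (cplAt K B t) C (spinAt a) ≤ gksExpect s (cplAt K B t) C (spinAt a) :=
    mul_le_of_le_one_left ha0 (gksExpect_pair_le_one s C _ z (p i))
  have hprod : 0 ≤ gksExpect s (cplAt K B t) C (spinAt a) * gksExpect s (cplAt K B t) C (spinAt z) *
      gksExpect s (cplAt K B t) C (spinAt (p i)) :=
    mul_nonneg (mul_nonneg ha0 hz0) hp0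
  have ha1 : gksExpect s (cplAt K B t) C (spinAt a) ≤ gksExpect s K C (spinAt a) :=
    gksExpect_spinAt_cplAt_le s K C B hK ht0 ht1 a
  have hz1 : gksExpect s (cplAt K B t) C (spinAt z) ≤ gksExpect s K C (spinAt z) :=
    gksExpect_spinAt_cplAt_le s K C B hK ht0 ht1 z
  linarith

/-- **The GHS interpolation bound for two-point functions**: for `Kᵢ ≥ 0` on supports of at
most two sites and a set `B ⊆ s` of one-body terms `Kᵢ σ_{pᵢ}`,
`⟨σ_aσ_z⟩_K - ⟨σ_aσ_z⟩_{K off B} ≤ (∑_{i∈B} Kᵢ)(⟨σ_a⟩_K + ⟨σ_z⟩_K)`. The derivative of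
`t ↦ ⟨σ_aσ_z⟩_{cplAt K B t}` is `∑_{i∈B} Kᵢ (⟨σ_aσ_zσ_{pᵢ}⟩_t - ⟨σ_aσ_z⟩_t⟨σ_{pᵢ}⟩_t)`
(Glimm–Jaffe 1987, Prop. 4.2.1; `hasDerivAt_gksExpect_cplAt_cov_single`), bounded on `[0, 1]`
by `sum_gksTrunc_three_cplAt_le` (GHS), and the mean value inequality concludes. Two-point
companion of `gksExpect_spinAt_sub_cplOff_le` (`MeanFieldBoundGHS`). [cite: Lebowitz1974, §2, Remark (ii) following the proof of the Theorem] [cite: GlimmJaffe1987, §4.2, Prop. 4.2.1] -/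
theorem gksExpect_pair_sub_cplOff_le (hK : ∀ i ∈ s, 0 ≤ K i) (hC : ∀ i ∈ s, (C i).card ≤ 2)
    (hBs : B ⊆ s) (hB : ∀ i ∈ B, C i = {p i}) (a z : Λ) :
    gksExpect s K C (fun ω => spinAt a ω * spinAt z ω) -
        gksExpect s (cplOff K B) C (fun ω => spinAt a ω * spinAt z ω) ≤
      (∑ i ∈ B, K i) * (gksExpect s K C (spinAt a) + gksExpect s K C (spinAt z)) := by
  set M := (∑ i ∈ B, K i) * (gksExpect s K C (spinAt a) + gksExpect s K C (spinAt z)) with hM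
  set Φ : ℝ → ℝ := fun t => gksExpect s (cplAt K B t) C (fun ω => spinAt a ω * spinAt z ω)
    with hΦ
  have hder : ∀ t, HasDerivAt Φ (∑ i ∈ B, K i *
      (gksExpect s (cplAt K B t) C (fun ω => spinAt a ω * spinAt z ω * spinAt (p i) ω) -
        gksExpect s (cplAt K B t) C (fun ω => spinAt a ω * spinAt z ω) *
          gksExpect s (cplAt K B t) C (spinAt (p i)))) t :=
    fun t => hasDerivAt_gksExpect_cplAt_cov_single s K C B p hBs hB
      (fun ω => spinAt a ω * spinAt z ω) t
  have hdiff : Differentiable ℝ Φ := fun t => (hder t).differentiableAt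
  have hderiv_le : ∀ t ∈ interior (Set.Icc (0 : ℝ) 1), deriv Φ t ≤ M := by
    intro t ht
    rw [interior_Icc] at ht
    rw [(hder t).deriv]
    exact sum_gksTrunc_three_cplAt_le s K C B p hK hC hBs ht.1.le ht.2.le a z
  have hmvt := (convex_Icc (0 : ℝ) 1).image_sub_le_mul_sub_of_deriv_le
    hdiff.continuous.continuousOn hdiff.differentiableOn hderiv_le 0
    (Set.left_mem_Icc.2 zero_le_one) 1 (Set.right_mem_Icc.2 zero_le_one) zero_le_one
  have h1 : Φ 1 = gksExpect s K C (fun ω => spinAt a ω * spinAt z ω) := by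
    simp only [hΦ, cplAt_one]
  have h0 : Φ 0 = gksExpect s (cplOff K B) C (fun ω => spinAt a ω * spinAt z ω) := by
    simp only [hΦ, cplAt_zero]
  rw [h1, h0, sub_zero, mul_one] at hmvt
  exact hmvt

end GKS

/-! ## Part A'. The Ising model: `+` versus free boundary condition on two-point functions -/

section Ising

variable {V : Type*} [DecidableEq V] (G : SimpleGraph V) [G.LocallyFinite]

/-- **GHS boundary-field bound for the two-point functions of the Ising model.** On a locally
finite graph, for a finite volume `Λ`, `β ≥ 0`, `h ≥ 0` and `a, z ∈ Λ`:
`⟨σ_aσ_z⟩⁺_{Λ;β,h} - ⟨σ_aσ_z⟩^∅_{Λ;β,h} ≤ β · #{(x, y) | x ∈ Λ, y ∉ Λ, x ∼ y} · (⟨σ_a⟩⁺_{Λ;β,h} + ⟨σ_z⟩⁺_{Λ;β,h})`.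
The `+` boundary condition is the free one plus the one-body terms `β σ_x`, one for each
boundary bond `{x, y}` (Friedli–Velenik 2017, §3.8.1, p. 141: "`K_{{i}} = h + β #{j ∉ Λ : j ∼ i}`");
apply `gksExpect_pair_sub_cplOff_le` (GHS). The bookkeeping of the boundary terms is that of
`isingCorr_plus_sub_free_le_boundary_cov` (`MeanFieldBoundGHS`). [cite: FriedliVelenik2017, §3.8.1, p. 141] [cite: Lebowitz1974, §2, Remark (ii) following the proof of the Theorem] -/
theorem isingTwoPoint_plus_sub_free_le_boundary {Λ : Finset V} {β h : ℝ} (hβ : 0 ≤ β)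
    (hh : 0 ≤ h) {a z : V} (ha : a ∈ Λ) (hz : z ∈ Λ) :
    isingTwoPoint G Λ β h .plus a z - isingTwoPoint G Λ β h .free a z ≤
      β * #(Λ.sigma fun x => (G.neighborFinset x).filter (· ∉ Λ)) *
        (isingCorr G Λ β h .plus {a} + isingCorr G Λ β h .plus {z}) := by
  classical
  set s := isingIdx G Λ with hs
  set K := gksCoupling G Λ β h .plus with hKdef
  set C := isingSupp Λ with hCdef
  set T := Λ.sigma (fun x => (G.neighborFinset x).filter (· ∉ Λ)) with hT
  set emb : (Σ _ : V, V) → Sym2 V ⊕ V := fun q => Sum.inl s(q.1, q.2) with hemb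
  set B := T.image emb with hB
  have hex : ∀ i, i ∈ B → ∃ q, q ∈ T ∧ emb q = i := fun i hi => by
    simpa only [hB, Finset.mem_image] using hi
  haveI : Nonempty (Σ _ : V, V) := ⟨⟨a, a⟩⟩
  choose! pf hpfT hpf using hex
  set p : Sym2 V ⊕ V → ↥Λ := fun i => if h : (pf i).1 ∈ Λ then ⟨(pf i).1, h⟩ else ⟨a, ha⟩
    with hp
  have hpfT' : ∀ i ∈ B, (pf i).1 ∈ Λ ∧ (pf i).2 ∉ Λ ∧ G.Adj (pf i).1 (pf i).2 :=
    fun i hi => (mem_outPairs G).1 (hpfT i hi)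
  have hp_val : ∀ i ∈ B, ((p i : ↥Λ) : V) = (pf i).1 := by
    intro i hi; simp only [hp, dif_pos (hpfT' i hi).1]
  have hTedge : ∀ q ∈ T, s(q.1, q.2) ∈ edgesTouching G Λ := by
    intro q hq
    obtain ⟨h1, _, hadj⟩ := (mem_outPairs G).1 hq
    exact mem_edgesTouching_iff.2 ⟨(SimpleGraph.mem_edgeSet G).2 hadj, q.1, h1, Sym2.mem_mk_left _ _⟩
  have hBs : B ⊆ s := by
    intro i hi
    obtain ⟨q, hq, rfl⟩ := Finset.mem_image.1 hi
    simp only [hs, isingIdx, hemb, Finset.inl_mem_disjSum]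
    exact hTedge q hq
  have hK : ∀ i ∈ s, 0 ≤ K i := gksCoupling_nonneg G hβ hh (Or.inr rfl)
  have hC : ∀ i ∈ s, (C i).card ≤ 2 := fun i _ => card_isingSupp_le_two Λ i
  have hBC : ∀ i ∈ B, C i = {p i} := by
    intro i hi
    obtain ⟨_, h2, _⟩ := hpfT' i hi
    have hi' : i = Sum.inl s((pf i).1, (pf i).2) := (hpf i hi).symm
    ext w
    rw [Finset.mem_singleton, Subtype.ext_iff, hp_val i hi]
    conv_lhs => rw [hi']
    simp only [hCdef, isingSupp, Finset.mem_filter, Finset.mem_univ, true_and, Sym2.mem_iff]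
    constructor
    · rintro (hw | hw)
      · exact hw
      · exact absurd (hw ▸ w.2) h2
    · exact fun hw => Or.inl hw
  -- switching off `B` turns the `+` couplings into the free ones
  have hoff : cplOff K B = gksCoupling G Λ β h .free := by
    funext i
    rcases i with e | x
    · by_cases hiB : Sum.inl e ∈ B
      · simp only [cplOff, hiB, if_true]
        obtain ⟨q, hq, hqe⟩ := Finset.mem_image.1 hiB
        obtain ⟨_, h2, _⟩ := (mem_outPairs G).1 hq
        have he : e ∉ edgesIn G Λ := by
          intro he
          refine h2 ((mem_edgesIn_iff.1 he).2 q.2 ?_)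
          rw [← Sum.inl_injective hqe]
          exact Sym2.mem_mk_right _ _
        simp [gksCoupling, interactionEdges_free, he]
      · simp only [cplOff, hiB, if_false]
        by_cases he : e ∈ edgesIn G Λ
        · rw [hKdef, gksCoupling_inl_of_mem_edgesIn G β h (Or.inr rfl) he,
            gksCoupling_inl_of_mem_edgesIn G β h (Or.inl rfl) he]
        · have het : e ∉ edgesTouching G Λ := by
            intro het
            obtain ⟨he', x, hx, hxe⟩ := mem_edgesTouching_iff.1 het
            apply hiB
            induction e using Sym2.ind with
            | _ u v =>
              have huv : G.Adj u v := (SimpleGraph.mem_edgeSet G).1 he'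
              have hout : u ∉ Λ ∨ v ∉ Λ := by
                by_contra hcon
                push Not at hcon
                exact he (mem_edgesIn_iff.2 ⟨he', fun w hw => by
                  rcases Sym2.mem_iff.1 hw with rfl | rfl
                  exacts [hcon.1, hcon.2]⟩)
              rcases Sym2.mem_iff.1 hxe with rfl | rfl
              · have hv : v ∉ Λ := hout.resolve_left (not_not.2 hx)
                exact Finset.mem_image.2 ⟨⟨x, v⟩, (mem_outPairs G).2 ⟨hx, hv, huv⟩, rfl⟩
              · have hu : u ∉ Λ := hout.resolve_right (not_not.2 hx)
                refine Finset.mem_image.2 ⟨⟨x, u⟩, (mem_outPairs G).2 ⟨hx, hu, huv.symm⟩, ?_⟩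
                simp only [hemb, Sym2.eq_swap]
          have h1 : K (Sum.inl e) = 0 := by
            simp only [hKdef, gksCoupling, BoundaryCondition.plus, interactionEdges_fixed, het,
              if_false]
          have h2 : gksCoupling G Λ β h .free (Sum.inl e) = 0 := by
            simp only [gksCoupling, interactionEdges_free, he, if_false]
          rw [h1, h2]
    · have hxB : Sum.inr x ∉ B := by
        intro hxB
        obtain ⟨q, _, hq⟩ := Finset.mem_image.1 hxB
        exact Sum.inl_ne_inr hq
      simp only [cplOff, hxB, if_false, hKdef, gksCoupling]
  -- the abstract bound
  have hmain := gksExpect_pair_sub_cplOff_le s K C B p hK hC hBs hBC ⟨a, ha⟩ ⟨z, hz⟩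
  rw [hoff] at hmain
  have hl : isingTwoPoint G Λ β h .plus a z - isingTwoPoint G Λ β h .free a z =
      gksExpect s K C (fun ω => spinAt (⟨a, ha⟩ : ↥Λ) ω * spinAt (⟨z, hz⟩ : ↥Λ) ω) -
        gksExpect s (gksCoupling G Λ β h .free) C
          (fun ω => spinAt (⟨a, ha⟩ : ↥Λ) ω * spinAt (⟨z, hz⟩ : ↥Λ) ω) := by
    rw [isingTwoPoint_eq_gksExpect G Λ β h .plus ha hz, isingTwoPoint_eq_gksExpect G Λ β h .free ha hz]
    rfl
  rw [hl]
  refine hmain.trans (le_of_eq ?_)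
  rw [← isingCorr_singleton_eq_gksExpect G Λ β h .plus ha,
    ← isingCorr_singleton_eq_gksExpect G Λ β h .plus hz]
  congr 1
  -- `∑_{i ∈ B} Kᵢ = β · #T`
  have hterm : ∀ q ∈ T, K (emb q) = β := fun q hq => gksCoupling_plus_inl G β h (hTedge q hq)
  rw [hB, Finset.sum_image (injOn_outPairs G Λ), Finset.sum_congr rfl hterm, Finset.sum_const,
    nsmul_eq_mul, mul_comm]

end Ising

/-! ## Part B. `ℤ^d` below `β̃_c`: `⟨σ₀σ_x⟩⁺ = ⟨σ₀σ_x⟩^∅`, and the plus-state decay -/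

section Zd

variable {d : ℕ}

/-- The ordered boundary bonds `(x, y)`, `x ∈ Λ`, `y ∉ Λ`, `x ∼ y`, of a finite `Λ ⊂ ℤ^d` number at
most `2d · #Λ` (every site has at most `2d` neighbours). [folklore] -/
theorem card_outPairs_le (Λ : Finset (Site d)) :
    (#(Λ.sigma fun x => ((zdGraph d).neighborFinset x).filter (· ∉ Λ)) : ℝ) ≤ 2 * d * #Λ := by
  rw [Finset.card_sigma]
  have h : ∑ x ∈ Λ, #(((zdGraph d).neighborFinset x).filter (· ∉ Λ)) ≤ ∑ _x ∈ Λ, 2 * d :=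
    Finset.sum_le_sum fun x _ => (Finset.card_filter_le _ _).trans (card_neighborFinset_zdGraph_le x)
  rw [Finset.sum_const, smul_eq_mul] at h
  calc ((∑ x ∈ Λ, #(((zdGraph d).neighborFinset x).filter (· ∉ Λ)) : ℕ) : ℝ)
      ≤ ((#Λ * (2 * d) : ℕ) : ℝ) := by exact_mod_cast h
    _ = 2 * d * #Λ := by push_cast; ring

/-- **The free-state decay below `β̃_c`, unconditionally**: for `β > 0` and a finite `S ∋ 0` with
`φ_β(S) < 1`, `⟨σ₀σ_x⟩^∅_{β,0} ≤ e^{-c‖x‖}` for some `c > 0` and all `x` —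
`SharpnessSubcritical.twoPointFree_exp_decay_of_dctIsingPhi_lt_one` fed with the tree theorems
(the finite-volume modified Simon inequality `dct_modifiedSimon_finiteVolume_holds`, translation
covariance, GKS I–II, the box limit of the free state). (Duminil-Copin–Tassion 2016, §2.5, third
item of Thm. 2.1 with `β̃_c`, for the free state.) [cite: DuminilCopinTassionCMP2016, §2.5, proof of Thm. 2.1, third item (arXiv:1502.03050 numbering)] -/
theorem exists_twoPointFree_exp_decay_of_dctIsingPhi_lt_one {β : ℝ} (hβ : 0 < β)
    {S : Finset (Site d)} (h0 : (0 : Site d) ∈ S) (hφ : dctIsingPhi d β S < 1) :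
    ∃ c > 0, ∀ x : Site d, twoPointFree d β x ≤ Real.exp (-c * ‖x‖) := by
  have hgks : ∀ {Λ A : Finset (Site d)} {β h : ℝ} {bc : BoundaryCondition (Site d)},
      gks_one (zdGraph d) (Λ := Λ) (A := A) (β := β) (h := h) (bc := bc) :=
    GKSInequalities.gks_one_holds (zdGraph d)
  have hgks2 : ∀ (G' : SimpleGraph (Site d)) [G'.LocallyFinite] (Λ A B : Finset (Site d))
      (β h : ℝ) (bc : BoundaryCondition (Site d)),
      gks_two G' (Λ := Λ) (A := A) (B := B) (β := β) (h := h) (bc := bc) :=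
    fun G' _ _ _ _ _ _ _ => GKSInequalities.gks_two_holds G'
  exact twoPointFree_exp_decay_of_dctIsingPhi_lt_one dct_modifiedSimon_finiteVolume_holds
    isingTwoPoint_free_translate_holds hgks hasBoxLimit_isingCorr_free_holds
    (isingCorr_free_mono_volume_of_gks_two hgks2) hβ h0 hφ

/-- **The one-point function of the `+` state in a box, from the decay of the free two-point
function** (GHS): if `⟨σ₀σ_x⟩^∅_{β,0} ≤ e^{-c‖x‖}` for all `x` (`β, c ≥ 0`), then for `a ∈ Λ_L`,
`⟨σ_a⟩⁺_{Λ_L;β,0} ≤ β · 2d (2L+1)^d · e^{c‖a‖} e^{-cL}`: by the GHS boundary-field bound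
`⟨σ_a⟩⁺_Λ ≤ β ∑_{x ∈ Λ, y ∼ x, y ∉ Λ} ⟨σ_aσ_x⟩^∅_Λ` (`isingCorr_plus_singleton_le_boundary_twoPoint`),
`⟨σ_aσ_x⟩^∅_{Λ} ≤ ⟨σ₀σ_{x-a}⟩^∅ ≤ e^{-c‖x-a‖}` (GKS volume monotonicity, translation covariance)
and `‖x - a‖ ≥ L - ‖a‖` on the sphere `‖x‖ = L`. (Friedli–Velenik 2017, §3.9, p. 140, on this
use of the GHS inequality.) [cite: FriedliVelenik2017, §3.9, p. 140] [cite: Lebowitz1974, §2, Remark (ii) following the proof of the Theorem] -/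
theorem isingCorr_plus_singleton_box_le_of_decay {β c : ℝ} (hβ : 0 ≤ β) (hc : 0 ≤ c)
    (hdec : ∀ x : Site d, twoPointFree d β x ≤ Real.exp (-c * ‖x‖)) {L : ℕ} {a : Site d}
    (ha : a ∈ box d L) :
    isingCorr (zdGraph d) (box d L) β 0 .plus {a} ≤
      β * ((2 * d : ℝ) * (2 * L + 1 : ℝ) ^ d * (Real.exp (c * ‖a‖) * Real.exp (-c * L))) := by
  have hgks2 : ∀ (G' : SimpleGraph (Site d)) [G'.LocallyFinite] (Λ A B : Finset (Site d))
      (β h : ℝ) (bc : BoundaryCondition (Site d)),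
      gks_two G' (Λ := Λ) (A := A) (B := B) (β := β) (h := h) (bc := bc) :=
    fun G' _ _ _ _ _ _ _ => GKSInequalities.gks_two_holds G'
  have hmono : isingCorr_free_mono_volume (d := d) := isingCorr_free_mono_volume_of_gks_two hgks2
  have hlim : hasBoxLimit_isingCorr_free d := hasBoxLimit_isingCorr_free_holds
  refine (isingCorr_plus_singleton_le_boundary_twoPoint (zdGraph d) hβ ha).trans ?_
  refine mul_le_mul_of_nonneg_left ?_ hβ
  have hterm : ∀ x ∈ box d L, ∀ y ∈ ((zdGraph d).neighborFinset x).filter (· ∉ box d L),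
      isingTwoPoint (zdGraph d) (box d L) β 0 .free a x ≤
        Real.exp (c * ‖a‖) * Real.exp (-c * L) := by
    intro x hx y hy
    rw [Finset.mem_filter, SimpleGraph.mem_neighborFinset] at hy
    have hn : Site.supNorm x = L := supNorm_eq_of_mem_box_of_adj_not_mem hx hy.2 hy.1
    refine (isingTwoPoint_free_le_twoPointFree_sub hmono hlim isingTwoPoint_free_translate_holds
      hβ ha hx).trans ?_
    refine (hdec (x - a)).trans ?_
    rw [← Real.exp_add]
    refine Real.exp_le_exp.2 ?_
    have h1 : ‖x‖ - ‖a‖ ≤ ‖x - a‖ := norm_sub_norm_le x a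
    have h2 : ‖x‖ = L := by rw [Site.norm_eq_supNorm, hn]
    rw [h2] at h1
    have h3 := mul_le_mul_of_nonneg_left h1 hc
    linarith
  calc ∑ x ∈ box d L, ∑ y ∈ ((zdGraph d).neighborFinset x).filter (· ∉ box d L),
        isingTwoPoint (zdGraph d) (box d L) β 0 .free a x
      ≤ ∑ x ∈ box d L, ∑ _y ∈ ((zdGraph d).neighborFinset x).filter (· ∉ box d L),
          Real.exp (c * ‖a‖) * Real.exp (-c * L) :=
        Finset.sum_le_sum fun x hx => Finset.sum_le_sum fun y hy => hterm x hx y hy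
    _ ≤ ∑ _x ∈ box d L, (2 * d : ℝ) * (Real.exp (c * ‖a‖) * Real.exp (-c * L)) := by
        refine Finset.sum_le_sum fun x _ => ?_
        rw [Finset.sum_const, nsmul_eq_mul]
        refine mul_le_mul_of_nonneg_right ?_ (by positivity)
        have h1 : #(((zdGraph d).neighborFinset x).filter (· ∉ box d L)) ≤ 2 * d :=
          (Finset.card_filter_le _ _).trans (card_neighborFinset_zdGraph_le x)
        exact_mod_cast h1
    _ = (2 * d : ℝ) * (2 * L + 1 : ℝ) ^ d * (Real.exp (c * ‖a‖) * Real.exp (-c * L)) := by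
        rw [Finset.sum_const, nsmul_eq_mul, card_box]
        push_cast
        ring

/-- **`⟨σ₀σ_z⟩⁺_{Λ_L} - ⟨σ₀σ_z⟩^∅_{Λ_L}` is exponentially small in `L`**: if
`⟨σ₀σ_x⟩^∅_{β,0} ≤ e^{-c‖x‖}` for all `x` (`β, c ≥ 0`), then for `z ∈ Λ_L`,
`⟨σ₀σ_z⟩⁺_{Λ_L;β,0} - ⟨σ₀σ_z⟩^∅_{Λ_L;β,0} ≤ β² (2d (2L+1)^d)² (1 + e^{c‖z‖}) e^{-cL}`
(`isingTwoPoint_plus_sub_free_le_boundary` with at most `2d (2L+1)^d` boundary bonds, and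
`isingCorr_plus_singleton_box_le_of_decay` for `⟨σ₀⟩⁺_{Λ_L}`, `⟨σ_z⟩⁺_{Λ_L}`). [cite: Lebowitz1974, §2, Remark (ii) following the proof of the Theorem] [cite: FriedliVelenik2017, §3.9, p. 140] -/
theorem isingTwoPoint_plus_sub_free_box_le_of_decay {β c : ℝ} (hβ : 0 ≤ β) (hc : 0 ≤ c)
    (hdec : ∀ x : Site d, twoPointFree d β x ≤ Real.exp (-c * ‖x‖)) {L : ℕ} {z : Site d}
    (hz : z ∈ box d L) :
    isingTwoPoint (zdGraph d) (box d L) β 0 .plus 0 z -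
        isingTwoPoint (zdGraph d) (box d L) β 0 .free 0 z ≤
      β ^ 2 * ((2 * d : ℝ) * (2 * L + 1 : ℝ) ^ d) ^ 2 *
        ((1 + Real.exp (c * ‖z‖)) * Real.exp (-c * L)) := by
  have h0 : (0 : Site d) ∈ box d L := zero_mem_box d L
  set P : ℝ := (2 * d : ℝ) * (2 * L + 1 : ℝ) ^ d with hP
  have hP0 : 0 ≤ P := by positivity
  have hcard : (#((box d L).sigma fun x => ((zdGraph d).neighborFinset x).filter (· ∉ box d L)) : ℝ)
      ≤ P := by
    refine (card_outPairs_le (box d L)).trans (le_of_eq ?_)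
    rw [card_box, hP]
    push_cast
    ring
  have ha' := isingCorr_plus_singleton_box_le_of_decay hβ hc hdec h0
  have hz' := isingCorr_plus_singleton_box_le_of_decay hβ hc hdec hz
  rw [norm_zero, mul_zero, Real.exp_zero, one_mul] at ha'
  have hT := isingTwoPoint_plus_sub_free_le_boundary (zdGraph d) hβ le_rfl h0 hz
  have hE0 : 0 ≤ isingCorr (zdGraph d) (box d L) β 0 .plus {0} :=
    GKSInequalities.gks_one_holds (zdGraph d) hβ le_rfl (Or.inr rfl)
      (Finset.singleton_subset_iff.2 h0)
  have hEz : 0 ≤ isingCorr (zdGraph d) (box d L) β 0 .plus {z} :=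
    GKSInequalities.gks_one_holds (zdGraph d) hβ le_rfl (Or.inr rfl)
      (Finset.singleton_subset_iff.2 hz)
  have key : β * (#((box d L).sigma fun x => ((zdGraph d).neighborFinset x).filter
        (· ∉ box d L)) : ℝ) *
      (isingCorr (zdGraph d) (box d L) β 0 .plus {0} + isingCorr (zdGraph d) (box d L) β 0 .plus {z}) ≤
      β * P * (β * (P * Real.exp (-c * L)) + β * (P * (Real.exp (c * ‖z‖) * Real.exp (-c * L)))) :=
    mul_le_mul (mul_le_mul_of_nonneg_left hcard hβ) (add_le_add ha' hz') (add_nonneg hE0 hEz)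
      (mul_nonneg hβ hP0)
  refine hT.trans (key.trans (le_of_eq ?_))
  ring

/-- **`⟨σ₀σ_x⟩⁺_{β,0} = ⟨σ₀σ_x⟩^∅_{β,0}` below `β̃_c`.** For the nearest-neighbour Ising model on
`ℤ^d`, `d ≥ 1`, `β > 0`, and a finite `S ∋ 0` with `φ_β(S) < 1`, the plus and free two-point
functions at zero field coincide: `⟨σ₀σ_x⟩^∅ ≤ ⟨σ₀σ_x⟩⁺` is GKS (Friedli–Velenik 2017,
Exercise 3.25; `twoPointFree_le_twoPointPlus_holds`), and in the boxes `Λ_L`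
`0 ≤ ⟨σ₀σ_x⟩⁺_{Λ_L} - ⟨σ₀σ_x⟩^∅_{Λ_L} = O(L^{2d} e^{-cL}) → 0` by the GHS bound
`isingTwoPoint_plus_sub_free_box_le_of_decay` and the free decay
(`exists_twoPointFree_exp_decay_of_dctIsingPhi_lt_one`), both box sequences converging
(`hasBoxLimit_isingCorr_plus_holds`, `hasBoxLimit_isingCorr_free_holds`). (Below `β_c` all
these states coincide, Friedli–Velenik 2017, §3.7.4; here is the part of that statement the
decay argument yields directly.) [cite: FriedliVelenik2017, Exercise 3.25 and §3.9, p. 140] [cite: DuminilCopinTassionCMP2016, §2.5 (arXiv:1502.03050 numbering)] -/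
theorem twoPointPlus_eq_twoPointFree_of_dctIsingPhi_lt_one (hd : 1 ≤ d) {β : ℝ} (hβ : 0 < β)
    {S : Finset (Site d)} (h0 : (0 : Site d) ∈ S) (hφ : dctIsingPhi d β S < 1) (x : Site d) :
    twoPointPlus d β x = twoPointFree d β x := by
  obtain ⟨c, hc, hdec⟩ := exists_twoPointFree_exp_decay_of_dctIsingPhi_lt_one hβ h0 hφ
  refine le_antisymm ?_ (twoPointFree_le_twoPointPlus_holds hd hβ.le x)
  have hplus := tendsto_isingTwoPoint_plus hasBoxLimit_isingCorr_plus_holds hβ.le x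
  have hfree := tendsto_isingTwoPoint_free hasBoxLimit_isingCorr_free_holds hβ.le x
  -- the error term `A L^{2d} r^L → 0`
  set r : ℝ := Real.exp (-c) with hr
  have hr0 : 0 < r := Real.exp_pos _
  have hr1 : r < 1 := Real.exp_lt_one_iff.2 (by linarith)
  have hpow : Tendsto (fun L : ℕ => (L : ℝ) ^ (2 * d) * r ^ L) atTop (𝓝 0) :=
    tendsto_pow_const_mul_const_pow_of_abs_lt_one (2 * d) (by rwa [abs_of_pos hr0])
  set A : ℝ := β ^ 2 * ((2 * d : ℝ) * (3 : ℝ) ^ d) ^ 2 * (1 + Real.exp (c * ‖x‖)) with hA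
  have herr : Tendsto (fun L : ℕ => A * ((L : ℝ) ^ (2 * d) * r ^ L)) atTop (𝓝 0) := by
    simpa only [mul_zero] using hpow.const_mul A
  have hev : ∀ᶠ L : ℕ in atTop, isingTwoPoint (zdGraph d) (box d L) β 0 .plus 0 x ≤
      isingTwoPoint (zdGraph d) (box d L) β 0 .free 0 x + A * ((L : ℝ) ^ (2 * d) * r ^ L) := by
    filter_upwards [eventually_mem_box x, eventually_ge_atTop 1] with L hL hL1
    have h := isingTwoPoint_plus_sub_free_box_le_of_decay hβ.le hc.le hdec hL
    have hexp : Real.exp (-c * L) = r ^ L := by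
      rw [hr, ← Real.exp_nat_mul]
      congr 1
      ring
    have hL1' : (1 : ℝ) ≤ L := by exact_mod_cast hL1
    have h3 : (2 * L + 1 : ℝ) ^ d ≤ (3 : ℝ) ^ d * (L : ℝ) ^ d := by
      rw [← mul_pow]
      exact pow_le_pow_left₀ (by positivity) (by linarith) d
    have h4 : ((2 * d : ℝ) * (2 * L + 1 : ℝ) ^ d) ^ 2 ≤
        ((2 * d : ℝ) * (3 : ℝ) ^ d) ^ 2 * (L : ℝ) ^ (2 * d) := by
      have h5 : (2 * d : ℝ) * (2 * L + 1 : ℝ) ^ d ≤ (2 * d : ℝ) * ((3 : ℝ) ^ d * (L : ℝ) ^ d) :=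
        mul_le_mul_of_nonneg_left h3 (by positivity)
      calc ((2 * d : ℝ) * (2 * L + 1 : ℝ) ^ d) ^ 2
          ≤ ((2 * d : ℝ) * ((3 : ℝ) ^ d * (L : ℝ) ^ d)) ^ 2 := pow_le_pow_left₀ (by positivity) h5 2
        _ = ((2 * d : ℝ) * (3 : ℝ) ^ d) ^ 2 * (L : ℝ) ^ (2 * d) := by ring
    have hbound : β ^ 2 * ((2 * d : ℝ) * (2 * L + 1 : ℝ) ^ d) ^ 2 *
        ((1 + Real.exp (c * ‖x‖)) * Real.exp (-c * L)) ≤ A * ((L : ℝ) ^ (2 * d) * r ^ L) := by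
      rw [hexp, hA]
      have hnn : 0 ≤ β ^ 2 * ((1 + Real.exp (c * ‖x‖)) * r ^ L) := by positivity
      calc β ^ 2 * ((2 * d : ℝ) * (2 * L + 1 : ℝ) ^ d) ^ 2 * ((1 + Real.exp (c * ‖x‖)) * r ^ L)
          = ((2 * d : ℝ) * (2 * L + 1 : ℝ) ^ d) ^ 2 * (β ^ 2 * ((1 + Real.exp (c * ‖x‖)) * r ^ L)) := by
            ring
        _ ≤ ((2 * d : ℝ) * (3 : ℝ) ^ d) ^ 2 * (L : ℝ) ^ (2 * d) *
              (β ^ 2 * ((1 + Real.exp (c * ‖x‖)) * r ^ L)) :=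
            mul_le_mul_of_nonneg_right h4 hnn
        _ = β ^ 2 * ((2 * d : ℝ) * (3 : ℝ) ^ d) ^ 2 * (1 + Real.exp (c * ‖x‖)) *
              ((L : ℝ) ^ (2 * d) * r ^ L) := by ring
    linarith
  have hlim2 : Tendsto (fun L : ℕ => isingTwoPoint (zdGraph d) (box d L) β 0 .free 0 x +
      A * ((L : ℝ) ^ (2 * d) * r ^ L)) atTop (𝓝 (twoPointFree d β x + 0)) := hfree.add herr
  rw [add_zero] at hlim2
  exact le_of_tendsto_of_tendsto hplus hlim2 hev

/-- **Duminil-Copin–Tassion 2016, Thm. 2.1, third item, with `β̃_c` in place of `β_c`, for the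
plus state — the named fact `dct_twoPointPlus_exponentialDecay` of `MeanFieldBound` discharged.**
For the nearest-neighbour Ising model on `ℤ^d`, `d ≥ 1`, `β > 0` and a finite `S ∋ 0` with
`φ_β(S) < 1`: `⟨σ₀σ_x⟩⁺_{β,0} ≤ C e^{-c‖x‖}` for all `x`, with `c = c(β, S) > 0` and (here)
`C = 1`. Proof: the free two-point function decays at rate `c`
(`exists_twoPointFree_exp_decay_of_dctIsingPhi_lt_one`: the source's §2.5 iteration of the
finite-volume modified Simon inequality, Lemma 2.7), and the plus two-point function equals the
free one in this regime (`twoPointPlus_eq_twoPointFree_of_dctIsingPhi_lt_one`, GHS). The source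
obtains the plus-state statement from the positive-field Lemma 2.7 and `h ↘ 0` instead. [cite: DuminilCopinTassionCMP2016, Thm. 2.1 (third item) and §2.5, proof of Thm. 2.1 items 2–3, Lemma 2.7 (arXiv:1502.03050 numbering)] -/
theorem dct_twoPointPlus_exponentialDecay_holds : dct_twoPointPlus_exponentialDecay (d := d) := by
  intro hd β hβ S h0 hφ
  obtain ⟨c, hc, hdec⟩ := exists_twoPointFree_exp_decay_of_dctIsingPhi_lt_one hβ h0 hφ
  refine ⟨c, hc, 1, fun x => ?_⟩
  rw [one_mul, twoPointPlus_eq_twoPointFree_of_dctIsingPhi_lt_one hd hβ h0 hφ x]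
  exact hdec x

end Zd

end Literature.Probability.LatticeModels
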